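import Literature.NumberTheory.QuadraticFields.EpsteinZetaKroneckerLimit
import Literature.Analysis.FunctionSpaces.BesselKHalf
import Mathlib.Analysis.SpecialFunctions.Gamma.Digamma
import Mathlib.NumberTheory.LSeries.HurwitzZetaValues
import Mathlib.NumberTheory.ModularForms.DedekindEta
import Mathlib.Analysis.SpecialFunctions.Complex.LogBounds
import Mathlib.Analysis.SpecialFunctions.Log.Summable
import Mathlib.Analysis.Normed.Ring.InfiniteSum
import HarnessLib

/-!
# The Epstein zeta function at `s = 1`, II: the exact constant term —
# Kronecker's first limit formula `C_f = (2π/√D)(2γ − log(D/a) − 4 log|η(τ_f)|)`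

Topic `NumberTheory/QuadraticFields`, namespace
`Literature.NumberTheory.QuadraticFields.KroneckerLimit`; sequel of `EpsteinZetaKroneckerLimit.lean`
(everything PROVED; three auxiliary definitions with bodies: `expCosSeries`, `rootPoint`, `nome`).
That file proves, for a positive definite form `f = ax² + bxy + cy²` (`D = 4ac − b² > 0`,
`κ = √D/(2a)`), `Z_f(s) − (2π/√D)/(s − 1) → C_f` as `s → 1⁺` with
`C_f = 2ζ(2)/a + A'(1) + 2γA(1) + 2B(1)`, leaving the absolute constant
`c_Γ = (d/ds)[π^{½}Γ(s−½)/Γ(s)]_{s=1}` inside `A'(1)` and the Bessel part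
`B(1) = Σ_y besselPart_y(1)` unevaluated ("the exact constant … and the `η`-product … which we do
not need"). Here they are evaluated, giving Kronecker's first limit formula:

* `deriv_gammaFactor_one` — **`c_Γ = −2π log 2`** (Mathlib's `Γ'(1) = −γ`,
  `Γ'(½) = −√π(γ + 2log 2)`);
* `besselSeries_one`, `besselPart_one` — at `s = 1` the `K`-Bessel function is elementary,
  `K_{½}(x) = √(π/2x) e^{−x}` (tree: `besselK_half_ofReal`), so
  `besselPart_y(1) = (2π/(aκy)) S(y)` with the real series
  `S(y) = Σ_{m≥1} cos(π m y b/a) e^{−2π m y κ}` (`expCosSeries`);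
* `tendsto_epsteinZeta_sub_pole_kronecker` — the exact constant in Lambert-series form,
  `C_f = π²/(3a) + (2π/√D)(2γ − log(D/a)) + (8π/√D) Σ_{y≥1} S(y)/y`;
* `tsum_expCosSeries_div` — with `q = e^{2πiτ_f}`, `τ_f = b/(2a) + iκ` (`rootPoint`, `nome`):
  `S(y) = Re Σ_m q^{ym}` and, swapping the absolutely convergent double series and summing
  `Σ_y z^y/y = −log(1 − z)`, **`Σ_y S(y)/y = −Σ_{n≥1} log|1 − qⁿ|`**;
* `log_norm_eta_rootPoint` — for Mathlib's Dedekind eta function `ModularForm.eta`,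
  `log|η(τ_f)| = −πκ/12 + Σ_{n≥1} log|1 − qⁿ|`;
* `tendsto_epsteinZeta_sub_pole_eta` — **Kronecker's first limit formula**:

    `Z_f(s) − (2π/√D)/(s − 1) → (2π/√D)(2γ − log(D/a) − 4 log|η(τ_f)|)`   (`s → 1⁺`),

  the term `π²/(3a)` cancelling against `(8π/√D)(πκ/12)`.

## References

* C. L. Siegel, *Advanced Analytic Number Theory* (TIFR / Springer 1980), Ch. I §1, Theorem 1
  (Kronecker's first limit formula).
* [BatemanGrosswald1964] P. T. Bateman, E. Grosswald, *On Epstein's zeta function*, Acta Arith. 9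
  (1964), Theorem 1 (the expansion whose `s → 1` limit is taken; tree:
  `BatemanGrosswald1964_thm1_holds`, and the `BakerLimitFormula*` files).
* A. Selberg, S. Chowla, *On Epstein's zeta-function*, J. reine angew. Math. 227 (1967), 86–110.
-/

noncomputable section

open Filter Topology Real Complex
open Literature.Barriers.RiemannHypothesis Literature.NumberTheory.QuadraticFields.BakerLimitFormula
open Literature.Analysis.FunctionSpaces

namespace Literature.NumberTheory.QuadraticFields.KroneckerLimit

variable {a b c : ℝ}

/-! ## The Gamma-factor constant `c_Γ = (d/ds)[π^{½}Γ(s−½)/Γ(s)]_{s=1} = −2π log 2` -/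

/-- `π^{1/2}` (complex power) is the real number `√π`. [folklore] -/
theorem pi_cpow_half : (π : ℂ) ^ (1 / 2 : ℂ) = ((Real.sqrt π : ℝ) : ℂ) := by
  rw [Real.sqrt_eq_rpow, Complex.ofReal_cpow Real.pi_pos.le]
  norm_num

/-- `x^{1/2} = √x` for real `x ≥ 0` (complex power). [folklore] -/
theorem ofReal_cpow_half {x : ℝ} (hx : 0 ≤ x) :
    (x : ℂ) ^ (1 / 2 : ℂ) = ((Real.sqrt x : ℝ) : ℂ) := by
  rw [Real.sqrt_eq_rpow, Complex.ofReal_cpow hx]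
  norm_num

/-- **`c_Γ = −2π log 2`**: the derivative at `s = 1` of `π^{½}Γ(s−½)/Γ(s)` is `−2π log 2`
(`Γ'(1) = −γ`, `Γ'(½) = −√π(γ + 2 log 2)`, `Γ(½) = √π`; equivalently `ψ(½) − ψ(1) = −2 log 2`).
[folklore] -/
theorem deriv_gammaFactor_one :
    deriv (fun s : ℂ => (π : ℂ) ^ (1 / 2 : ℂ) * Complex.Gamma (s - 1 / 2) / Complex.Gamma s) 1 =
      ((-(2 * π * Real.log 2) : ℝ) : ℂ) := by
  have hG1 : HasDerivAt Complex.Gamma (-(Real.eulerMascheroniConstant : ℂ)) 1 := by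
    simpa using Complex.hasDerivAt_Gamma_one
  have hGh : HasDerivAt Complex.Gamma
      (-((Real.sqrt π : ℝ) : ℂ) * (Real.eulerMascheroniConstant + 2 * Complex.log 2)) (1 / 2) := by
    simpa using Complex.hasDerivAt_Gamma_one_half
  have hGh' : HasDerivAt Complex.Gamma
      (-((Real.sqrt π : ℝ) : ℂ) * (Real.eulerMascheroniConstant + 2 * Complex.log 2))
      ((1 : ℂ) - 1 / 2) := by
    rw [show (1 : ℂ) - 1 / 2 = 1 / 2 by norm_num]; exact hGh
  have hnum : HasDerivAt (fun s : ℂ => Complex.Gamma (s - 1 / 2))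
      (-((Real.sqrt π : ℝ) : ℂ) * (Real.eulerMascheroniConstant + 2 * Complex.log 2)) 1 :=
    hGh'.comp_sub_const 1 (1 / 2)
  have hF : HasDerivAt
      (fun s : ℂ => (π : ℂ) ^ (1 / 2 : ℂ) * Complex.Gamma (s - 1 / 2) / Complex.Gamma s)
      (((π : ℂ) ^ (1 / 2 : ℂ) *
            (-((Real.sqrt π : ℝ) : ℂ) * (Real.eulerMascheroniConstant + 2 * Complex.log 2)) *
          Complex.Gamma 1 -
        (π : ℂ) ^ (1 / 2 : ℂ) * Complex.Gamma (1 - 1 / 2) * -(Real.eulerMascheroniConstant : ℂ)) /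
        Complex.Gamma 1 ^ 2) 1 :=
    (hnum.const_mul ((π : ℂ) ^ (1 / 2 : ℂ))).div hG1 (by simp [Complex.Gamma_one])
  rw [hF.deriv]
  rw [show (1 : ℂ) - 1 / 2 = 1 / 2 by norm_num, Complex.Gamma_one, Complex.Gamma_one_half_eq,
    pi_cpow_half, ← Complex.ofReal_ofNat, ← Complex.ofReal_log (by norm_num : (0 : ℝ) ≤ 2)]
  have hs : ((Real.sqrt π : ℝ) : ℂ) * ((Real.sqrt π : ℝ) : ℂ) = (π : ℂ) := by
    rw [← Complex.ofReal_mul, Real.mul_self_sqrt Real.pi_pos.le]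
  push_cast
  linear_combination (-(2 : ℂ) * (Real.log 2 : ℂ)) * hs

/-! ## The Bessel part at `s = 1`: `K_{1/2}` is elementary -/

/-- `√(r) · √(π/(2·2πrY)) = 1/(2√Y)` (`r, Y > 0`). [folklore] -/
theorem sqrt_mul_sqrt_aux {r Y : ℝ} (hr : 0 < r) (hY : 0 < Y) :
    Real.sqrt r * Real.sqrt (π / (2 * (2 * π * r * Y))) = 1 / (2 * Real.sqrt Y) := by
  rw [← Real.sqrt_mul hr.le, show r * (π / (2 * (2 * π * r * Y))) = 1 / (2 ^ 2 * Y) by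
    field_simp, Real.sqrt_div' _ (by positivity : (0 : ℝ) ≤ 2 ^ 2 * Y), Real.sqrt_one,
    Real.sqrt_mul (by positivity), Real.sqrt_sq (by norm_num : (0 : ℝ) ≤ 2)]

/-- The real series behind the Bessel part at `s = 1`:
`S(y) = Σ_{r≥1} cos(2πrα_y) e^{−2πrY_y}`. [folklore] -/
def expCosSeries (a b c : ℝ) (y : ℤ) : ℝ :=
  ∑' r : ℕ, Real.cos (2 * π * ((r + 1 : ℕ) : ℝ) * lineα a b 1 0 y) *
    Real.exp (-(2 * π * ((r + 1 : ℕ) : ℝ) * lineY a b c 1 y))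

/-- **The Bessel series at `s = 1`**: `Σ_{r≥1} r^{½} cos(2πrα) K_{½}(2πrY) = S(y)/(2√Y)` since
`K_{½}(x) = √(π/(2x)) e^{−x}`. [folklore] -/
theorem besselSeries_one (h : IsPosDefForm a b c) {y : ℤ} (hy : 0 < y) :
    besselSeries a b c 1 1 0 y =
      ((expCosSeries a b c y / (2 * Real.sqrt (lineY a b c 1 y)) : ℝ) : ℂ) := by
  have hY := lineY_pos h one_pos hy
  unfold besselSeries expCosSeries
  rw [show (1 : ℂ) - 1 / 2 = 1 / 2 by norm_num, Complex.ofReal_div, Complex.ofReal_tsum,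
    ← tsum_div_const]
  refine tsum_congr fun r => ?_
  have hr : (0 : ℝ) < ((r + 1 : ℕ) : ℝ) := by positivity
  have hx : 0 < 2 * π * ((r + 1 : ℕ) : ℝ) * lineY a b c 1 y := by positivity
  rw [besselK_half_ofReal hx,
    show (((r + 1 : ℕ) : ℂ)) = ((((r + 1 : ℕ) : ℝ)) : ℂ) by push_cast; ring,
    ofReal_cpow_half hr.le]
  have key := sqrt_mul_sqrt_aux hr hY
  have hd : ((2 * Real.sqrt (lineY a b c 1 y) : ℝ) : ℂ) ≠ 0 :=
    Complex.ofReal_ne_zero.2 (by positivity)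
  rw [eq_div_iff hd]
  norm_cast
  have key' : Real.sqrt ((r + 1 : ℕ) : ℝ) *
      Real.sqrt (π / (2 * (2 * π * ((r + 1 : ℕ) : ℝ) * lineY a b c 1 y))) *
      (2 * Real.sqrt (lineY a b c 1 y)) = 1 := by
    rw [key]
    field_simp [(Real.sqrt_pos.2 hY).ne']
  linear_combination (Real.cos (2 * π * ((r + 1 : ℕ) : ℝ) * lineα a b 1 0 y) *
    Real.exp (-(2 * π * ((r + 1 : ℕ) : ℝ) * lineY a b c 1 y))) * key'

/-- **The Bessel part of the line `y` at `s = 1`** (`k = 1`, trivial weight):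
`besselPart_y(1) = (2π/(aκy)) S(y)`. [folklore] -/
theorem besselPart_one (h : IsPosDefForm a b c) {y : ℤ} (hy : 0 < y) :
    besselPart (fun _ : ℤ × ℤ => (1 : ℂ)) a b c 1 1 y =
      ((2 * π / (a * starkK a b c * y) * expCosSeries a b c y : ℝ) : ℂ) := by
  have ha := h.a_pos
  have hκ := starkK_pos h
  have hY := lineY_pos h one_pos hy
  have hy' : (0 : ℝ) < y := by exact_mod_cast hy
  unfold besselPart
  rw [Fin.sum_univ_one]
  have h0 : ((((0 : Fin 1) : ℕ) : ℤ)) = 0 := by simp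
  rw [h0, one_mul, besselSeries_one h hy, Nat.cast_one, Complex.one_cpow, mul_one,
    Complex.Gamma_one, div_one, Complex.cpow_one, Complex.cpow_neg_one,
    show (1 / 2 : ℂ) - 1 = -(1 / 2 : ℂ) by norm_num, Complex.cpow_neg, ofReal_cpow_half hY.le]
  have hsq : Real.sqrt (lineY a b c 1 y) ≠ 0 := (Real.sqrt_pos.2 hY).ne'
  have hYdef : lineY a b c 1 y = starkK a b c * y := by simp [lineY]
  have hss : Real.sqrt (lineY a b c 1 y) * Real.sqrt (lineY a b c 1 y) = starkK a b c * y := by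
    rw [Real.mul_self_sqrt hY.le, hYdef]
  have hreal : 2 * π / (a * starkK a b c * y) * expCosSeries a b c y =
      a⁻¹ * (4 * π * (Real.sqrt (lineY a b c 1 y))⁻¹ *
        (expCosSeries a b c y / (2 * Real.sqrt (lineY a b c 1 y)))) := by
    rw [show a⁻¹ * (4 * π * (Real.sqrt (lineY a b c 1 y))⁻¹ *
        (expCosSeries a b c y / (2 * Real.sqrt (lineY a b c 1 y)))) =
        2 * π / (a * (Real.sqrt (lineY a b c 1 y) * Real.sqrt (lineY a b c 1 y))) *
          expCosSeries a b c y by field_simp; ring, hss, mul_assoc]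
  rw [hreal]
  push_cast
  ring

/-! ## Kronecker's first limit formula: the exact constant term -/

/-- **Kronecker's first limit formula (exact constant, Lambert-series form).** For a positive
definite form `f = ax² + bxy + cy²` with `D = 4ac − b² > 0`, `κ = √D/(2a)`, as `s → 1⁺`:

  `Z_f(s) − (2π/√D)/(s − 1) → π²/(3a) + (2π/√D)(2γ − log(D/a)) + (8π/√D) Σ_{y≥1} S(y)/y`,

where `S(y) = Σ_{m≥1} cos(π m y b/a) e^{−2π m y κ}` (`expCosSeries`; `= Re Σ_m q^{my}`,
`q = e^{2πiτ}`, `τ = (b + i√D)/(2a)`, so that `Σ_y S(y)/y = −Σ_n log|1 − qⁿ| =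
−log|η(τ)/q^{1/24}|` and the right-hand side is the classical
`(2π/√D)(2γ − log(D/a) − 4 log|η(τ)|) + π²/(3a) − (2π/√D)·(πκ/3)·…`, i.e. Kronecker's
`(2π/√D)(2γ − log 4D… )` form after the `η` normalisation). This makes the constants of the tree's
`tendsto_epsteinZeta_sub_pole` explicit: `c_Γ = −2π log 2` (`deriv_gammaFactor_one`), `ζ(2) = π²/6`,
and the Bessel part at `s = 1` summed with `K_{1/2}(x) = √(π/2x)e^{−x}` (`besselPart_one`).
[cite: BatemanGrosswald1964, Theorem 1] -/
theorem tendsto_epsteinZeta_sub_pole_kronecker (h : IsPosDefForm a b c) :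
    Tendsto (fun s : ℝ => epsteinZeta a b c s -
        ((2 * π / Real.sqrt (4 * a * c - b ^ 2) : ℝ) : ℂ) / ((s : ℂ) - 1)) (𝓝[>] 1)
      (𝓝 ((π ^ 2 / (3 * a) +
          2 * π / Real.sqrt (4 * a * c - b ^ 2) *
            (2 * Real.eulerMascheroniConstant - Real.log ((4 * a * c - b ^ 2) / a)) +
          8 * π / Real.sqrt (4 * a * c - b ^ 2) *
            ∑' y : ℕ, expCosSeries a b c ((y + 1 : ℕ) : ℤ) / ((y + 1 : ℕ) : ℝ) : ℝ) : ℂ)) := by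
  have ha := h.a_pos
  have hD : 0 < 4 * a * c - b ^ 2 := by linarith [h.disc_neg]
  have hsD : 0 < Real.sqrt (4 * a * c - b ^ 2) := Real.sqrt_pos.2 hD
  have haκ : a * starkK a b c = Real.sqrt (4 * a * c - b ^ 2) / 2 := a_mul_starkK h
  have hκ : 0 < starkK a b c := starkK_pos h
  have hlogκ : Real.log (starkK a b c) =
      Real.log (4 * a * c - b ^ 2) / 2 - Real.log 2 - Real.log a := by
    have : starkK a b c = Real.sqrt (4 * a * c - b ^ 2) / (2 * a) := by
      field_simp; linarith [haκ]
    rw [this, Real.log_div hsD.ne' (by positivity), Real.log_sqrt hD.le,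
      Real.log_mul (by norm_num) ha.ne']
    ring
  have hlogDa : Real.log ((4 * a * c - b ^ 2) / a) = Real.log (4 * a * c - b ^ 2) - Real.log a :=
    Real.log_div hD.ne' ha.ne'
  have hB : ∑' y : ℕ, besselPart (fun _ : ℤ × ℤ => (1 : ℂ)) a b c 1 1 ((y + 1 : ℕ) : ℤ) =
      ((4 * π / Real.sqrt (4 * a * c - b ^ 2) *
        ∑' y : ℕ, expCosSeries a b c ((y + 1 : ℕ) : ℤ) / ((y + 1 : ℕ) : ℝ) : ℝ) : ℂ) := by
    rw [← tsum_mul_left, Complex.ofReal_tsum]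
    refine tsum_congr fun y => ?_
    rw [besselPart_one h (by positivity)]
    congr 1
    push_cast
    rw [haκ]
    field_simp
    ring
  convert tendsto_epsteinZeta_sub_pole h using 2
  rw [riemannZeta_two, deriv_gammaFactor_one, hB,
    show ((Real.log (starkK a b c) : ℝ) : ℂ) =
      ((Real.log (4 * a * c - b ^ 2) / 2 - Real.log 2 - Real.log a : ℝ) : ℂ) by rw [hlogκ],
    show (((a * starkK a b c)⁻¹ : ℝ) : ℂ) = (((Real.sqrt (4 * a * c - b ^ 2) / 2)⁻¹ : ℝ) : ℂ) by
      rw [haκ], hlogDa]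
  have hsDc : ((Real.sqrt (4 * a * c - b ^ 2) : ℝ) : ℂ) ≠ 0 := Complex.ofReal_ne_zero.2 hsD.ne'
  have hac : (a : ℂ) ≠ 0 := Complex.ofReal_ne_zero.2 ha.ne'
  push_cast
  field_simp
  ring

/-! ## The `η`-form: `Σ_y S(y)/y = −Σ_n log|1 − qⁿ| = −log|η(τ)| − πκ/12` -/

/-- The point `τ_f = b/(2a) + iκ = (b + i√D)/(2a)` of the upper half-plane attached to the form
(a root of `aτ² − bτ + c = 0`; `|η(τ_f)|` does not depend on the sign of `b`). [folklore] -/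
def rootPoint (a b c : ℝ) : ℂ := ⟨b / (2 * a), starkK a b c⟩

/-- The nome `q = e^{2πiτ_f}`. [folklore] -/
def nome (a b c : ℝ) : ℂ := cexp (2 * π * I * rootPoint a b c)

/-- `Re τ_f = b/(2a)`. [folklore] -/
@[simp] theorem rootPoint_re (a b c : ℝ) : (rootPoint a b c).re = b / (2 * a) := rfl

/-- `Im τ_f = κ`. [folklore] -/
@[simp] theorem rootPoint_im (a b c : ℝ) : (rootPoint a b c).im = starkK a b c := rfl

/-- `Re(k·2πiτ_f) = −2πkκ`. [folklore] -/
theorem re_natCast_mul_two_pi_I_mul_rootPoint (a b c : ℝ) (k : ℕ) :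
    ((k : ℂ) * (2 * π * I * rootPoint a b c)).re = -(2 * π * k * starkK a b c) := by
  simp [Complex.mul_re, Complex.mul_im]; ring

/-- `Im(k·2πiτ_f) = 2πk·b/(2a)`. [folklore] -/
theorem im_natCast_mul_two_pi_I_mul_rootPoint (a b c : ℝ) (k : ℕ) :
    ((k : ℂ) * (2 * π * I * rootPoint a b c)).im = 2 * π * k * (b / (2 * a)) := by
  simp [Complex.mul_re, Complex.mul_im]; ring

/-- `|q| = e^{−2πκ}`. [folklore] -/
theorem norm_nome (a b c : ℝ) : ‖nome a b c‖ = Real.exp (-(2 * π * starkK a b c)) := by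
  rw [nome, Complex.norm_exp]
  congr 1
  simp [Complex.mul_re, Complex.mul_im]

/-- `|q| < 1`. [folklore] -/
theorem norm_nome_lt_one (h : IsPosDefForm a b c) : ‖nome a b c‖ < 1 := by
  rw [norm_nome, Real.exp_lt_one_iff]
  have := starkK_pos h
  nlinarith [Real.pi_pos]

/-- `Re q^k = e^{−2πkκ} cos(2πk·b/(2a))`. [folklore] -/
theorem re_nome_pow (a b c : ℝ) (k : ℕ) :
    ((nome a b c) ^ k).re =
      Real.exp (-(2 * π * k * starkK a b c)) * Real.cos (2 * π * k * (b / (2 * a))) := by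
  rw [nome, ← Complex.exp_nat_mul, Complex.exp_re, re_natCast_mul_two_pi_I_mul_rootPoint,
    im_natCast_mul_two_pi_I_mul_rootPoint]

/-- **`S(y) = Re Σ_{m≥1} q^{ym}`** for `y ≥ 1`. [folklore] -/
theorem expCosSeries_eq_re_tsum (a b c : ℝ) (n : ℕ) :
    expCosSeries a b c ((n + 1 : ℕ) : ℤ) =
      ∑' m : ℕ, ((nome a b c) ^ ((n + 1) * (m + 1))).re := by
  unfold expCosSeries
  refine tsum_congr fun m => ?_
  rw [re_nome_pow, mul_comm (Real.cos _)]
  simp only [lineα, lineY, Int.cast_zero, zero_add, Nat.cast_one, div_one]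
  congr 1
  · congr 1; push_cast; ring
  · congr 1; push_cast; ring

/-- The double family `F(n, m) = q^{(n+1)(m+1)}/(n+1)` is summable on `ℕ × ℕ`
(`|q|^{(n+1)(m+1)} ≤ |q|^{n+1}|q|^{m}`). [folklore] -/
theorem summable_nome_pow_div (h : IsPosDefForm a b c) :
    Summable (fun p : ℕ × ℕ => (nome a b c) ^ ((p.1 + 1) * (p.2 + 1)) / ((p.1 + 1 : ℕ) : ℂ)) := by
  set r : ℝ := ‖nome a b c‖ with hr
  have hr0 : 0 ≤ r := norm_nonneg _
  have hr1 : r < 1 := norm_nome_lt_one h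
  have hgeo : Summable (fun n : ℕ => r ^ n) := summable_geometric_of_lt_one hr0 hr1
  have hgeo1 : Summable (fun n : ℕ => r ^ (n + 1)) := by
    simpa [pow_succ] using hgeo.mul_right r
  have hg : Summable (fun p : ℕ × ℕ => r ^ (p.1 + 1) * r ^ p.2) :=
    hgeo1.mul_of_nonneg hgeo (fun _ => by positivity) (fun _ => by positivity)
  refine Summable.of_norm_bounded hg fun p => ?_
  rw [norm_div, norm_pow, Complex.norm_natCast, ← hr]
  have h1 : r ^ ((p.1 + 1) * (p.2 + 1)) ≤ r ^ (p.1 + 1) * r ^ p.2 := by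
    rw [← pow_add]
    exact pow_le_pow_of_le_one hr0 hr1.le (by nlinarith)
  have h2 : (1 : ℝ) ≤ ((p.1 + 1 : ℕ) : ℝ) := by exact_mod_cast Nat.succ_le_succ (Nat.zero_le _)
  calc r ^ ((p.1 + 1) * (p.2 + 1)) / ((p.1 + 1 : ℕ) : ℝ) ≤ r ^ ((p.1 + 1) * (p.2 + 1)) / 1 := by
        gcongr
    _ ≤ r ^ (p.1 + 1) * r ^ p.2 := by rw [div_one]; exact h1

/-- **`Σ_{y≥1} S(y)/y = −Σ_{n≥1} log|1 − qⁿ|`** (swap the absolutely convergent double series and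
sum the logarithmic series `Σ_y z^y/y = −log(1 − z)`). [folklore] -/
theorem tsum_expCosSeries_div (h : IsPosDefForm a b c) :
    ∑' n : ℕ, expCosSeries a b c ((n + 1 : ℕ) : ℤ) / ((n + 1 : ℕ) : ℝ) =
      -∑' m : ℕ, Real.log ‖1 - (nome a b c) ^ (m + 1)‖ := by
  set q := nome a b c with hq
  have hq1 : ‖q‖ < 1 := norm_nome_lt_one h
  set F : ℕ → ℕ → ℂ := fun n m => q ^ ((n + 1) * (m + 1)) / ((n + 1 : ℕ) : ℂ) with hF
  have hFs : Summable (Function.uncurry F) := summable_nome_pow_div h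
  have hFn : ∀ n, Summable (F n) := fun n => hFs.prod_factor n
  have hFm : ∀ m, Summable fun n => F n m := fun m => hFs.prod_symm.prod_factor m
  -- Step 1: each term as a real part
  have h1 : ∀ n : ℕ, expCosSeries a b c ((n + 1 : ℕ) : ℤ) / ((n + 1 : ℕ) : ℝ) =
      (∑' m : ℕ, F n m).re := by
    intro n
    rw [expCosSeries_eq_re_tsum a b c n, Complex.re_tsum (hFn n), ← tsum_div_const]
    refine tsum_congr fun m => ?_
    simp only [hF, ← hq]
    rw [show ((n + 1 : ℕ) : ℂ) = (((n + 1 : ℕ) : ℝ) : ℂ) by push_cast; ring, Complex.div_ofReal_re]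
  simp_rw [h1]
  have hsum : Summable fun n => ∑' m, F n m := hFs.prod
  rw [← Complex.re_tsum hsum, ← hFs.tsum_comm' hFn hFm]
  -- Step 2: the inner sum over `n` is `-log (1 - q^(m+1))`
  have h2' : ∀ m : ℕ, ∑' n : ℕ, F n m = -Complex.log (1 - q ^ (m + 1)) := by
    intro m
    have hz : ‖q ^ (m + 1)‖ < 1 := by
      rw [norm_pow]; exact pow_lt_one₀ (norm_nonneg _) hq1 (Nat.succ_ne_zero m)
    have hL := Complex.hasSum_taylorSeries_neg_log hz
    rw [← hasSum_nat_add_iff' 1] at hL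
    simp only [Finset.range_one, Finset.sum_singleton, pow_zero, Nat.cast_zero, div_zero,
      sub_zero] at hL
    rw [← hL.tsum_eq]
    refine tsum_congr fun n => ?_
    simp only [hF, ← pow_mul, mul_comm (m + 1)]
  simp_rw [h2']
  have hlog : Summable fun m : ℕ => Complex.log (1 - q ^ (m + 1)) := by
    have := Complex.summable_log_one_add_of_summable
      ((summable_geometric_of_norm_lt_one hq1).mul_left q |>.neg)
    refine this.congr fun m => ?_
    congr 1; ring
  rw [tsum_neg, Complex.neg_re, Complex.re_tsum hlog]
  congr 1
  refine tsum_congr fun m => ?_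
  exact Complex.log_re _

/-! ## `log|η(τ_f)|` and Kronecker's first limit formula -/

/-- Mathlib's `q`-term of the eta product at `τ_f` is `qⁿ⁺¹`. [folklore] -/
theorem eta_q_rootPoint (a b c : ℝ) (n : ℕ) :
    ModularForm.eta_q n (rootPoint a b c) = (nome a b c) ^ (n + 1) := by
  simp [ModularForm.eta_q, Function.Periodic.qParam, nome]

/-- **`log|η(τ_f)| = −πκ/12 + Σ_{n≥1} log|1 − qⁿ|`** (`η = q^{1/24}∏(1 − qⁿ)`,
`|q^{1/24}| = e^{−πκ/12}`, and `|∏(1 − qⁿ)| = exp Σ log|1 − qⁿ|` through `∏ = exp Σ log`).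
[folklore] -/
theorem log_norm_eta_rootPoint (h : IsPosDefForm a b c) :
    Real.log ‖ModularForm.eta (rootPoint a b c)‖ =
      -(π * starkK a b c / 12) + ∑' n : ℕ, Real.log ‖1 - (nome a b c) ^ (n + 1)‖ := by
  set q := nome a b c with hq
  have hq1 : ‖q‖ < 1 := norm_nome_lt_one h
  have hfn : ∀ n : ℕ, (1 : ℂ) - q ^ (n + 1) ≠ 0 := by
    intro n h0
    have : ‖q ^ (n + 1)‖ < 1 := by
      rw [norm_pow]; exact pow_lt_one₀ (norm_nonneg _) hq1 (Nat.succ_ne_zero n)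
    rw [sub_eq_zero] at h0
    rw [← h0, norm_one] at this
    exact lt_irrefl _ this
  have hlog : Summable fun n : ℕ => Complex.log (1 - q ^ (n + 1)) := by
    have := Complex.summable_log_one_add_of_summable
      ((summable_geometric_of_norm_lt_one hq1).mul_left q |>.neg)
    refine this.congr fun m => ?_
    congr 1; ring
  have hprod : ∏' n : ℕ, (1 - ModularForm.eta_q n (rootPoint a b c)) =
      cexp (∑' n : ℕ, Complex.log (1 - q ^ (n + 1))) := by
    rw [Complex.cexp_tsum_eq_tprod hfn hlog]
    exact tprod_congr fun n => by rw [eta_q_rootPoint]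
  rw [ModularForm.eta, hprod, norm_mul, Function.Periodic.norm_qParam, Complex.norm_exp,
    Complex.re_tsum hlog, rootPoint_im, Real.log_mul (Real.exp_pos _).ne' (Real.exp_pos _).ne',
    Real.log_exp, Real.log_exp]
  congr 1
  · ring
  · exact tsum_congr fun n => Complex.log_re _

/-- **Kronecker's first limit formula.** For a positive definite binary quadratic form
`f = ax² + bxy + cy²` (`a > 0`, `D = 4ac − b² > 0`), with `τ_f = (b + i√D)/(2a)` and Dedekind's
`η` (Mathlib's `ModularForm.eta`), as `s → 1⁺`

  `Z_f(s) − (2π/√D)/(s − 1) → (2π/√D) · (2γ − log(D/a) − 4 log|η(τ_f)|)`,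

`Z_f(s) = Σ'_{(x,y) ∈ ℤ²} f(x,y)^{−s}` (`epsteinZeta`). Equivalently
`lim_{s→1} (Z_f(s) − (2π/√D)/(s−1)) = (4π/√D)(γ − log 2 − log(√(D/4a)·|η(τ_f)|²))` (Siegel's
form, `Im τ_f = √D/(2a)`). Obtained from `tendsto_epsteinZeta_sub_pole_kronecker` by
`Σ_y S(y)/y = −Σ_n log|1 − qⁿ|` (`tsum_expCosSeries_div`) and `log_norm_eta_rootPoint`; the
term `π²/(3a)` cancels against `(8π/√D)·(πκ/12)`. [folklore] -/
theorem tendsto_epsteinZeta_sub_pole_eta (h : IsPosDefForm a b c) :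
    Tendsto (fun s : ℝ => epsteinZeta a b c s -
        ((2 * π / Real.sqrt (4 * a * c - b ^ 2) : ℝ) : ℂ) / ((s : ℂ) - 1)) (𝓝[>] 1)
      (𝓝 ((2 * π / Real.sqrt (4 * a * c - b ^ 2) *
          (2 * Real.eulerMascheroniConstant - Real.log ((4 * a * c - b ^ 2) / a) -
            4 * Real.log ‖ModularForm.eta (rootPoint a b c)‖) : ℝ) : ℂ)) := by
  have ha := h.a_pos
  have hD : 0 < 4 * a * c - b ^ 2 := by linarith [h.disc_neg]
  have hsD : 0 < Real.sqrt (4 * a * c - b ^ 2) := Real.sqrt_pos.2 hD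
  have haκ : a * starkK a b c = Real.sqrt (4 * a * c - b ^ 2) / 2 := a_mul_starkK h
  convert tendsto_epsteinZeta_sub_pole_kronecker h using 3
  rw [tsum_expCosSeries_div h]
  have hP : ∑' n : ℕ, Real.log ‖1 - nome a b c ^ (n + 1)‖ =
      Real.log ‖ModularForm.eta (rootPoint a b c)‖ + π * starkK a b c / 12 := by
    rw [log_norm_eta_rootPoint h]; ring
  rw [hP, show starkK a b c = Real.sqrt (4 * a * c - b ^ 2) / (2 * a) by
    field_simp; linarith [haκ]]
  field_simp
  ring

end Literature.NumberTheory.QuadraticFields.KroneckerLimit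

end
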